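import Summits.BirchSwinnertonDyer.Rank1Residual.Additive.KatoDescentLocPKummerLattice
import Summits.BirchSwinnertonDyer.Rank1Residual.Additive.KatoDescentLocPKummerTower
import Summits.BirchSwinnertonDyer.Rank1Residual.Additive.KatoDescentKummerLogLinear
import Summits.BirchSwinnertonDyer.Rank1Residual.X11b.BDPRouteRelaxation
import Summits.BirchSwinnertonDyer.Rank1Residual.GaloisImage.LocalEulerPoincareCharacteristicHolds
import Literature.NumberTheory.GaloisCohomology.PoitouTateNumberField
import Literature.NumberTheory.EllipticCurves.CanonicalPAdicHeightJunkSigmaProofs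
import HarnessLib

set_option autoImplicit false

/-!
# Display (4) LOG-EX of stub 3 PROVED: in analytic rank one every class of `H¹(ℤ[1/p], T_pW)` has a Kummer
# logarithm at `p` (`Kato2004.HasLocPKummerLog`) — indeed for EVERY `W/ℚ` with a rational point of infinite order
# and EVERY prime `p`; stub 3 `stub_rankOneCountReadingKato` now rests on three named facts + TWO displays
# (seat `bsd-cm-prr-ty1` g8, cell `bsd-cm`; theorems only: no definition, no named fact, no instance, no `sorry`)

Part 3 (assembly) of the seat's kernel proof of display (4) LOG-EX of `KatoDescentRankOneCountContraOfFacts.lean` (the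
hypothesis `hLogEx` of `ContraCount.rankOneCountReading_contra_of_facts_of_logHom`, p638935) for the Kato–Perrin-Riou
skeletons v4 of cruxes stmt-BirchSwinnertonDyer-19945 (`…/Lines/kato_perrin_riou_zp.lean`) and
stmt-BirchSwinnertonDyer-19223 (`…/Lines/kato_perrin_riou_istar.lean`) (= cell bsd-potss's held input 27322).  Parts 1–2:
`KatoDescentLocPKummerLattice.lean` (lattice algebra of `W(ℚ_p)`), `KatoDescentLocPKummerTower.lean` (level tower,
uniform «Kummer away from `p`» multiple).

MATHEMATICS (Kato, Astérisque 295, (14.9.3) ⊗ ℚ in positive rank; Bloch–Kato Ex. 3.11: `H¹_f(ℚ_p, V) = E(ℚ_p) ⊗ ℚ_p`).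
Let `x ∈ H¹(ℤ[1/p], T_pW)` and `c_k = red_{p^k} x ∈ H¹(ℚ, W[p^k])`.  By part 2, ONE `T ≠ 0` makes `T•c_k` Kummer at
every place `≠ v_p`, i.e. `T•c_k ∈ H¹_{𝓛, ⊤ at v_p}(ℚ, W[p^k])` for every `k`.  POITOU–TATE (cell b2b-bsdres,
`X11b.Relaxation.relIndex_selmerGroup_kummerOutside_le_of_facts`, JSW17 Prop. 3.2.1 `≤` half, fed by the TREE THEOREMS
`poitouTate_sum_localTatePairing_eq_zero_holds` (cell bsd-cn100) and `localEulerPoincareCharacteristic_holds` (cell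
b2b-bsdres)): `[H¹_{𝓛,⊤ at v_p} : Sel^{(p^k)}] ≤ [W(ℚ_p) : p^k W(ℚ_p) + im W(ℚ)]`, and the right side is bounded
UNIFORMLY in `k` as soon as `W(ℚ)` has a point `P₀` of infinite order (part 1: `W(ℚ_p) ≅ ℤ_p × finite` through the
logarithm) — this is where «analytic rank one» enters, via Gross–Zagier–Kolyvagin `rank W(ℚ) = 1 ≥ 1`; no finiteness
of `Ш` and no rank-ONE is used.  Hence ONE `M ≠ 0` with `M•c_k ∈ Sel^{(p^k)}(W/ℚ)` for every `k` (§1), so `loc_p(M x)`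
is levelwise a local Kummer class `κ_k(Q_k)`, `Q_k ∈ W(ℚ_p)` (§2); the tower (part 2) gives `Q_{k+1} ≡ Q_k (mod p^k)` and
the `p`-adic completeness of `W(ℚ_p)` (part 1) ONE point `Q` with `t•(Q − Q_k) ∈ p^k W(ℚ_p)`, whence
`loc_p((tM)•x) ≡ κ_k(t•Q) (mod p^k)` for every `k`: `HasLocPKummerLog W p x (log_ω(t•Q)/(tM))` (§3).

* §1 `exists_uniform_nsmul_mem_selmerGroup` — ONE `M ≠ 0` with `M • red_{p^{k+1}} x ∈ Sel^{(p^{k+1})}(W/ℚ)` for all `k`.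
* §2 `exists_localKummerMap_eq_locModPk` — a `p^k`-Selmer reduction has `loc_p ≡ κ_k(Q_k)`.
* §3 **`exists_hasLocPKummerLog_of_mem_integralH1`** — `W/ℚ` globally minimal, ANY prime `p`, `x ∈ H¹(⊤, T_pW)` integral,
  `P₀ ∈ W(ℚ)` of infinite order ⟹ `∃ t, HasLocPKummerLog W p x t`.
* §4 **`logEx_of_gzk`**: display (4) LOG-EX VERBATIM, from `rank_eq_analyticRank_of_analyticRank_le_one` (GZK) alone; and
  **`rankOneCountReading_contra_of_facts_of_gzk`**: STUB 3 (verbatim type `TorsionFree.RankOneCountReading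
  IsKatoZetaDescentDatumOfContra Kato2004.PRRatio`) from {GZK, `Kato2004.finite_descentCokernel_of_rankOne`,
  `IsNewformOf.level_eq_conductorNorm`} + the TWO remaining displays PR-INV (6) and COUNT (7).

HONEST LABEL: §1–§3 are unconditional theorems about the tree's objects; §4 is a conditional reduction on two displayed
hypotheses and three named facts; no stub or item is closed; nothing is registered; nothing is asserted on 19945 /
19223; Kato's Main Conjecture and Perrin-Riou's conjecture are not touched; BSD is not proved for any curve.

References: [Kato2004Asterisque] §8.2 / Lemma 8.5 (pp. 180–184), §13.8 (p. 228), §14.1 (p. 235), §14.9 (14.9.3) (p. 240);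
[BlochKato1990] Def. 3.10, Ex. 3.11; [JetchevSkinnerWan2017] Prop. 3.2.1 (arXiv:1512.06894 pp. 10–11); [MilneADT2006] I
Lemma 3.3, Thm. 2.8, Thm. 4.10 (b), §6 Lemma 6.15; [SilvermanAEC2009] IV.6.4, VII.6.3, VIII.§2, X.§4;
[AlpogeBhargavaShnidman2022] App. A §10.1.2–10.1.3 (pp. 33–34); [PerrinRiou1993AIF] §3.3.
-/

noncomputable section

open scoped Classical NumberField ContRepresentation

open CategoryTheory Field IsDedekindDomain NumberField
open Literature.NumberTheory.GaloisRepresentations Literature.NumberTheory.GaloisCohomology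
open Literature.NumberTheory.EllipticCurves Literature.NumberTheory.EllipticCurves.Kato2004
open Literature.NumberTheory.EllipticCurves.Kato2004.EulerSystemValues
open Literature.NumberTheory.EllipticCurves.ModularForms Literature.NumberTheory.EllipticCurves.Rank1Residual
open Literature.NumberTheory.EllipticCurves.IwasawaAlgebra
open WeierstrassCurve (geomPoints geomTorsion galH1Torsion selmerLocalKer selmerGroup torsionPoints)
open Summit.BirchSwinnertonDyer.Rank1Residual.X11b.Relaxation (relIndex_selmerGroup_kummerOutside_le_of_facts)

namespace Summit.BirchSwinnertonDyer.Rank1Residual.Additive.LocPKummer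

variable (W : WeierstrassCurve ℚ) [W.IsElliptic] (p : ℕ) [Fact p.Prime] [ContinuousSMul ℤ_[p] (W.tateModule p)]

/-! ## §1 A uniform `p^k`-Selmer multiple of the reductions of an integral class, in positive rank -/

/-- The relative index `[H¹_{𝓛, ⊤ at v₀}(ℚ, E[n]) : Sel⁽ⁿ⁾(E/ℚ)]` is NON-ZERO (finite): `Sel⁽ⁿ⁾ = loc_{v₀}⁻¹(𝓛_{v₀}) ∩
H¹_{𝓛,⊤ at v₀}`, so the quotient embeds into the finite `H¹(ℚ_{v₀}, E[n])` (steps (1)–(2) of cell b2b-bsdres's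
`X11b.Relaxation.relIndex_selmerGroup_kummerOutside_le`). [cite: MilneADT2006, I Lemma 3.3 and §6 (6.5)] -/
theorem relIndex_selmerGroup_kummerOutside_ne_zero (n : ℕ) [NeZero n] (v₀ : HeightOneSpectrum (𝓞 ℚ)) :
    (selmerGroup W (n : ℤ)).relIndex (kummerOutside W n {(Sum.inr v₀ : Place ℚ)}) ≠ 0 := by
  classical
  set M := W.torsionGaloisModule (n : ℤ) with hM
  set loc := galoisCohomology.localization M (Sum.inr v₀) 1 with hloc
  set L := W.kummerSelmerStructure n (Sum.inr v₀) with hL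
  set KO := kummerOutside W n {(Sum.inr v₀ : Place ℚ)} with hKO
  haveI : Finite (geomTorsion W (n : ℤ)) := finite_geomTorsion_of_neZero W n
  haveI hfinA : Finite (galoisCohomology (M.toLocal (Sum.inr v₀)) 1) := by
    change Finite (galoisCohomology (GaloisRep.restrictField (v₀.adicCompletion ℚ) (W.torsionGaloisModule n)) 1)
    -- (`CharZero ℚ_v` is passed explicitly: as a local instance it would let `DivisionRing.toRatAlgebra` pre-empt
    -- the completion's `ℚ`-algebra structure, cf. `KatoDescentKummerLogLinear` §3)
    exact @finite_galoisCohomology_one_of_isNonarchimedeanLocalField _ _ _ _ _ (charZero_adicCompletion _)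
      _ _ _ _ _ _
  -- (1) `Sel = comap L ⊓ KO`
  have hSel : selmerGroup W (n : ℤ) = L.comap loc ⊓ KO := by
    apply le_antisymm
    · intro c hc
      exact ⟨(W.mem_selmerGroup_iff_forall_localization_mem n c).mp hc (Sum.inr v₀),
        selmerGroup_le_kummerOutside W n _ hc⟩
    · rintro c ⟨hc₀, hcKO⟩
      refine mem_selmerGroup_of_mem_kummerOutside W n hcKO fun v => ?_
      obtain ⟨v, hv⟩ := v
      rw [Finset.mem_singleton] at hv
      subst hv
      exact hc₀
  -- (2) the relative index through `loc` is the index of a subgroup of the finite `loc(KO)`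
  have h2 : (L.comap loc ⊓ KO).relIndex KO ≠ 0 := by
    rw [AddSubgroup.inf_relIndex_right, AddSubgroup.relIndex_comap, AddSubgroup.relIndex]
    haveI : Finite (KO.map loc) := inferInstance
    exact AddSubgroup.FiniteIndex.index_ne_zero
  rw [hSel]
  exact h2

/-- **ONE `M ≠ 0` with `M • red_{p^{k+1}} x ∈ Sel^{(p^{k+1})}(W/ℚ)` for EVERY `k`**, for `x ∈ H¹(ℤ[1/p], T_pW)` (at `⊤`)
on a globally minimal curve with a rational point `P₀` of infinite order.  `M = C!·T`: `T` of part 2 makes `T•red x`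
Kummer away from `p` (`exists_uniform_nsmul_torsionH1OfDvd_mem_kummerOutside`); the Poitou–Tate relaxation bound
`[H¹_{𝓛,⊤ at v_p}(ℚ,W[n]) : Sel⁽ⁿ⁾] ≤ [W(ℚ_p) : nW(ℚ_p) + im W(ℚ)]` (cell b2b-bsdres's
`relIndex_selmerGroup_kummerOutside_le_of_facts`, fed by the tree THEOREMS `poitouTate_sum_localTatePairing_eq_zero_holds`
and `localEulerPoincareCharacteristic_holds`) and part 1's uniform `[W(ℚ_p) : p^k W(ℚ_p) + ℤP₀] ∣ C` give
`[H¹_{𝓛,⊤ at v_p} : Sel] ≤ C`, a non-zero index, so `C! •` a class of `H¹_{𝓛,⊤ at v_p}` is Selmer; the level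
dialects `(p:ℤ)^k` / `((p^k:ℕ):ℤ)` are bridged by part 2 §4. [cite: Kato2004Asterisque, §14.9 (14.9.3) (p. 240)]
[cite: JetchevSkinnerWan2017, Prop. 3.2.1 (proof, arXiv:1512.06894 pp. 10–11)] [cite: MilneADT2006, Ch. I, Thm. 4.10 (b) and Thm. 2.8] -/
theorem exists_uniform_nsmul_mem_selmerGroup [W.IsGloballyMinimal] {x : H1 (tateRep W p) ⊤}
    (hx : x ∈ integralH1 (tateRep W p) p ⊤) {P₀ : W.toAffine.Point} (hP₀ : ¬ IsOfFinAddOrder P₀) :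
    ∃ M : ℕ, M ≠ 0 ∧ ∀ k : ℕ,
      M • (ofTopSubgroup (W.torsionGaloisModule ((p : ℤ) ^ (k + 1))).toTopRep 1).hom (reduceH1Pk W p (k + 1) ⊤ x) ∈
        selmerGroup W ((p : ℤ) ^ (k + 1)) := by
  have hp : p.Prime := Fact.out
  -- part 2: `T • red x` is Kummer away from `p`
  obtain ⟨T, hT0, hT⟩ := exists_uniform_nsmul_torsionH1OfDvd_mem_kummerOutside W p hx
  -- part 1: the uniform index bound at `P₀` read in `W(ℚ_v)`, `v = primePlace p`
  have hPv0 : ¬ IsOfFinAddOrder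
      (WeierstrassCurve.Affine.Point.baseChange (W' := W) ℚ ((primePlace p).adicCompletion ℚ) P₀) := fun h =>
    hP₀ ((WeierstrassCurve.Affine.Point.map_injective (W' := W) _).isOfFinAddOrder_iff.mp h)
  obtain ⟨C, hC0, hC⟩ := exists_uniform_index_dvd W p hPv0
  refine ⟨C.factorial * T, Nat.mul_ne_zero (Nat.factorial_ne_zero C) hT0, fun k => ?_⟩
  haveI : NeZero (p ^ (k + 1)) := ⟨pow_ne_zero _ hp.ne_zero⟩
  -- the class `c = red_{p^{k+1}} x`, typed in `H¹(ℚ, W[p^{k+1}]) = galH1Torsion` (one ambient type for all `•`)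
  set c : galH1Torsion W ((p : ℤ) ^ (k + 1)) :=
    (ofTopSubgroup (W.torsionGaloisModule ((p : ℤ) ^ (k + 1))).toTopRep 1).hom (reduceH1Pk W p (k + 1) ⊤ x) with hc
  have hc' : WeierstrassCurve.torsionH1OfDvd W (intPow_dvd_natCast_pow' p (k + 1)) (T • c) ∈
      kummerOutside W (p ^ (k + 1)) {(Sum.inr (primePlace p) : Place ℚ)} := hT (k + 1)
  -- the relative index `r = [KO : Sel]` is non-zero and `≤ C`
  have hr0 := relIndex_selmerGroup_kummerOutside_ne_zero W (p ^ (k + 1)) (primePlace p)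
  have hPv : WeierstrassCurve.Affine.Point.baseChange (W' := W) ℚ ((primePlace p).adicCompletion ℚ) P₀ ∈
      (WeierstrassCurve.Affine.Point.baseChange (W' := W) ℚ ((primePlace p).adicCompletion ℚ)).range :=
    AddMonoidHom.mem_range.mpr ⟨P₀, rfl⟩
  have hidx : ((WeierstrassCurve.Affine.Point.baseChange (W' := W) ℚ ((primePlace p).adicCompletion ℚ)).range ⊔
      (zsmulAddGroupHom ((p ^ (k + 1) : ℕ) : ℤ) :
        (W.baseChange ((primePlace p).adicCompletion ℚ)).toAffine.Point →+ _).range).index ∣ C := by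
    refine (AddSubgroup.index_dvd_of_le
      (sup_le_sup (AddSubgroup.zmultiples_le_of_mem hPv) (le_of_eq ?_))).trans (hC (k + 1))
    rw [Nat.cast_pow]
  have hrle : (selmerGroup W ((p ^ (k + 1) : ℕ) : ℤ)).relIndex
      (kummerOutside W (p ^ (k + 1)) {(Sum.inr (primePlace p) : Place ℚ)}) ≤ C :=
    (relIndex_selmerGroup_kummerOutside_le_of_facts W (p ^ (k + 1)) (primePlace p)
      (hp.isPrimePow.pow (Nat.succ_ne_zero k)) (poitouTate_sum_localTatePairing_eq_zero_holds ℚ)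
      (@localEulerPoincareCharacteristic_holds _ _ _ _ _ (charZero_adicCompletion _))).trans
      (Nat.le_of_dvd (Nat.pos_of_ne_zero hC0) hidx)
  -- `C! •` a class of `KO` is Selmer
  obtain ⟨q, hq⟩ := Nat.dvd_factorial (Nat.pos_of_ne_zero hr0) hrle
  have hmem : C.factorial • WeierstrassCurve.torsionH1OfDvd W (intPow_dvd_natCast_pow' p (k + 1)) (T • c) ∈
      selmerGroup W ((p ^ (k + 1) : ℕ) : ℤ) := by
    rw [hq, mul_nsmul]
    exact AddSubgroup.nsmul_mem _ ((selmerGroup W ((p ^ (k + 1) : ℕ) : ℤ)).nsmul_relIndex_mem hc') q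
  have key : WeierstrassCurve.torsionH1OfDvd W (intPow_dvd_natCast_pow' p (k + 1)) ((C.factorial * T) • c) ∈
      selmerGroup W ((p ^ (k + 1) : ℕ) : ℤ) := by
    rw [mul_nsmul', map_nsmul]
    exact hmem
  exact (torsionH1OfDvd_mem_selmerGroup_iff W _ _).mp key

/-! ## §2 A `p^k`-Selmer reduction has `loc_p` a local Kummer class -/

/-- If `M • red_{p^k} y` lies in `Sel^{(p^k)}(W/ℚ)` then `loc_p(M • y) = κ_k(Q)` for some `Q ∈ W(ℚ_v)`, `v = primePlace p`
(the Selmer local condition at `v` is the Kummer condition, `comap_res_kummerLocalConditionAt`; the local Kummer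
sequence is exact on `W(ℚ_v)`-points, `range_localKummerMap`). [cite: SilvermanAEC2009, X.§4 diagram (**)] -/
theorem exists_localKummerMap_eq_locModPk (k M : ℕ) (y : H1 (tateRep W p) ⊤)
    (h : M • (ofTopSubgroup (W.torsionGaloisModule ((p : ℤ) ^ k)).toTopRep 1).hom (reduceH1Pk W p k ⊤ y) ∈
      selmerGroup W ((p : ℤ) ^ k)) :
    ∃ Q : (W.baseChange ((primePlace p).adicCompletion ℚ)).toAffine.Point,
      W.localKummerMap ((primePlace p).adicCompletion ℚ)
          (pow_ne_zero k (Int.natCast_ne_zero.mpr (Fact.out : p.Prime).ne_zero)) Q =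
        locModPk W p k (M • y) := by
  set c : galH1Torsion W ((p : ℤ) ^ k) :=
    (ofTopSubgroup (W.torsionGaloisModule ((p : ℤ) ^ k)).toTopRep 1).hom (reduceH1Pk W p k ⊤ y) with hc
  have h1 := ((W.mem_selmerGroup_iff _ _).mp h).1 (primePlace p)
  rw [← WeierstrassCurve.comap_res_kummerLocalConditionAt] at h1
  have h2 : galoisCohomology.res (W.torsionGaloisModule ((p : ℤ) ^ k)) ((primePlace p).adicCompletion ℚ) 1 (M • c) ∈
      W.kummerLocalConditionAt ((p : ℤ) ^ k) ((primePlace p).adicCompletion ℚ) := h1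
  -- (`CharZero ℚ_v` passed explicitly, see §1)
  rw [← @WeierstrassCurve.range_localKummerMap ℚ _ W _ _ _ _ _ _ (charZero_adicCompletion _)
    (pow_ne_zero k (Int.natCast_ne_zero.mpr (Fact.out : p.Prime).ne_zero))] at h2
  obtain ⟨Q, hQ⟩ := h2
  refine ⟨Q, ?_⟩
  rw [hQ, map_nsmul (locModPk W p k) M y, locModPk_apply]
  -- `res (M • c) = M • res c`, read on `galH1Torsion` (cf. cell bsd-cn100's `locP_kernel_isTorsion_of_rankOne_holds`)
  exact map_nsmul (galoisCohomology.res (W.torsionGaloisModule ((p : ℤ) ^ k)) ((primePlace p).adicCompletion ℚ) 1) M c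

/-! ## §3 The existence of Kummer logarithms -/

/-- **EXISTENCE OF THE KUMMER LOGARITHM** (Kato (14.9.3) ⊗ ℚ in positive rank / Bloch–Kato Ex. 3.11: the localisation
at `p` of a class of `H¹(ℤ[1/p], T_pW)` lies in `H¹_f(ℚ_p, T_pW) = W(ℚ_p) ⊗ ℤ_p` up to torsion as soon as `W(ℚ)` has a
point of infinite order).  For `W/ℚ` globally minimal, ANY prime `p`, every `x ∈ H¹(⊤, T_pW)` in `integralH1 … p ⊤` and a
point `P₀ ∈ W(ℚ)` of infinite order: `∃ t, HasLocPKummerLog W p x t` — there are `m ≠ 0` and ONE `Q ∈ W(ℚ_p)` with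
`loc_p(m • x) ≡ κ_k(Q) (mod p^k)` for every `k` (and `t = log_ω Q / m`). [cite: Kato2004Asterisque, §14.9 (14.9.3) (p. 240) and §14.1 (p. 235)]
[cite: BlochKato1990, Def. 3.10 and Ex. 3.11] [cite: AlpogeBhargavaShnidman2022, App. A §10.1.2 (p. 33)] -/
theorem exists_hasLocPKummerLog_of_mem_integralH1 [W.IsGloballyMinimal] {x : H1 (tateRep W p) ⊤}
    (hx : x ∈ integralH1 (tateRep W p) p ⊤) {P₀ : W.toAffine.Point} (hP₀ : ¬ IsOfFinAddOrder P₀) :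
    ∃ t : ℚ_[p], HasLocPKummerLog W p x t := by
  have hp : p.Prime := Fact.out
  have hpk : ∀ k : ℕ, ((p : ℤ) ^ k) ≠ 0 := fun k => pow_ne_zero k (Int.natCast_ne_zero.mpr hp.ne_zero)
  -- §1: the uniform Selmer multiple
  obtain ⟨M, hM0, hM⟩ := exists_uniform_nsmul_mem_selmerGroup W p hx hP₀
  -- §2: levelwise Kummer points at the levels `p^{k+1}`
  choose Q hQ using fun k => exists_localKummerMap_eq_locModPk W p (k + 1) M x (hM k)
  -- the transition maps and the tower: the same points work at level `p^k`
  choose F hF using fun k => exists_transition W p k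
  have hQk : ∀ k, W.localKummerMap ((primePlace p).adicCompletion ℚ) (hpk k) (Q k) =
      locModPk W p k (M • x) := fun k => by
    rw [← map_restrictField_localKummerMap_succ W p k (F k) (hF k) (Q k), hQ k,
      map_restrictField_locModPk_succ W p k (F k) (hF k)]
  -- compatibility `Q (k+1) - Q k ∈ p^k W(ℚ_v)` (indeed `∈ p^{k+1} W(ℚ_v) = ker κ_{k+1}`)
  have hcompat : ∀ k, Q (k + 1) - Q k ∈
      (zsmulAddGroupHom ((p : ℤ) ^ k) : (W.baseChange ((primePlace p).adicCompletion ℚ)).toAffine.Point →+ _).range := by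
    intro k
    have h1 : Q (k + 1) - Q k ∈ (W.localKummerMap ((primePlace p).adicCompletion ℚ) (hpk (k + 1))).ker := by
      rw [AddMonoidHom.mem_ker, map_sub, hQ k, hQk (k + 1), sub_self]
    rw [@WeierstrassCurve.ker_localKummerMap ℚ _ W _ _ _ _ _ _ (charZero_adicCompletion _) (hpk (k + 1))] at h1
    obtain ⟨R, hR⟩ := h1
    refine ⟨(p : ℤ) • R, ?_⟩
    rw [zsmulAddGroupHom_apply, ← hR, zsmulAddGroupHom_apply, smul_smul, ← pow_succ]
  -- part 1: glue the compatible sequence to ONE point, up to the torsion exponent `t`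
  obtain ⟨t, Qinf, ht0, hglue⟩ := exists_glue_adicCompletion W p Q hcompat
  have hQinf : ∀ k, W.localKummerMap ((primePlace p).adicCompletion ℚ) (hpk k) ((t : ℤ) • Qinf) =
      locModPk W p k ((t * M) • x) := by
    intro k
    have h1 : W.localKummerMap ((primePlace p).adicCompletion ℚ) (hpk k) ((t : ℤ) • Qinf - (t : ℤ) • Q k) = 0 := by
      rw [← zsmul_sub, ← AddMonoidHom.mem_ker,
        @WeierstrassCurve.ker_localKummerMap ℚ _ W _ _ _ _ _ _ (charZero_adicCompletion _) (hpk k)]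
      exact hglue k
    rw [map_sub, sub_eq_zero] at h1
    rw [h1, map_zsmul, hQk k, natCast_zsmul, ← map_nsmul, ← mul_nsmul']
  -- read `t • Qinf` in `W(ℚ_p)` and take `t_log = log_ω(t • Qinf) / (t M)`
  obtain ⟨Q', hQ'⟩ := ContraCount.exists_map_padicToAdic_eq W p ((t : ℤ) • Qinf)
  have hne : ((t * M : ℕ) : ℚ_[p]) ≠ 0 := Nat.cast_ne_zero.mpr (Nat.mul_ne_zero ht0 hM0)
  refine ⟨padicLogLocal W p Q' / ((t * M : ℕ) : ℚ_[p]), ?_⟩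
  unfold HasLocPKummerLog
  refine ⟨t * M, Q', Nat.mul_ne_zero ht0 hM0, fun k => ?_, (mul_div_cancel₀ _ hne).symm⟩
  rw [hQ', hQinf k]

/-! ## §4 Display (4) LOG-EX from Gross–Zagier–Kolyvagin, and stub 3 from three named facts + two displays -/

/-- **DISPLAY (4) LOG-EX of `KatoDescentRankOneCountContraOfFacts.lean` — PROVED from GZK alone** (verbatim the type of the
hypothesis `hLogEx` of `ContraCount.rankOneCountReading_contra_of_facts_of_logHom`): for `W/ℚ` globally minimal of
analytic rank one, every prime `p`, the cyclotomic datum `(κ, γ)` and every `x ∈ 𝐇¹_Γ(T_pW)`, the bottom class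
`proj₀ x ∈ H¹(ℤ[1/p], T_pW)` has a Kummer logarithm.  GZK (`rank_eq_analyticRank_of_analyticRank_le_one`) supplies a
rational point of infinite order (`rank W(ℚ) = 1 ≠ 0`); §3 does the rest — `κ`, `γ` and their hypotheses are not used.
[cite: Kato2004Asterisque, §14.9 (14.9.3) (p. 240)] [cite: BlochKato1990, Ex. 3.11] [cite: GrossZagier1986, Thm. I.7.3] -/
theorem logEx_of_gzk (hGZK : rank_eq_analyticRank_of_analyticRank_le_one) :
    ∀ (W : WeierstrassCurve ℚ) [W.IsElliptic] [W.IsGloballyMinimal] (p : ℕ) [Fact p.Prime],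
      letI : ContinuousSMul ℤ_[p] (W.tateModule p) := TateModule.continuousSMul_padicInt
      ∀ (κ : ZpExtension ℚ p) (γ : absoluteGaloisGroup ℚ), κ.IsCyclotomic → κ.IsTopGenerator γ →
        W.analyticRank = 1 → ∀ (I : IwasawaH1Data W p κ γ) (x : I.H),
          ∃ t : ℚ_[p], HasLocPKummerLog W p (layerZeroToTop W p κ (I.proj 0 x)) t := by
  intro W _ _ p _
  letI : ContinuousSMul ℤ_[p] (W.tateModule p) := TateModule.continuousSMul_padicInt
  intro κ γ _ _ hr I x
  obtain ⟨hmw, -⟩ := hGZK W (by rw [hr])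
  have hrank : W.mordellWeilRank ≠ 0 := by rw [hmw, hr]; exact one_ne_zero
  obtain ⟨P₀, hP₀⟩ := WeierstrassCurve.exists_not_isOfFinAddOrder_of_mordellWeilRank_ne_zero W hrank
  exact exists_hasLocPKummerLog_of_mem_integralH1 W p (layerZeroToTop_mem_integralH1 W p κ (I.proj_mem 0 x)) hP₀

/-- **STUB 3 `stub_rankOneCountReadingKato` from THREE named facts and TWO displays**: `TorsionFree.RankOneCountReading
IsKatoZetaDescentDatumOfContra Kato2004.PRRatio` (verbatim the stub's type in both v4 skeletons) from Gross–Zagier–Kolyvagin,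
`Kato2004.finite_descentCokernel_of_rankOne`, `IsNewformOf.level_eq_conductorNorm` and the displayed schemata PR-INV (6) and
COUNT (7) of `KatoDescentRankOneCountContraOfFacts.lean` — displays LOG-EX (4) (this file, `logEx_of_gzk`) and LOG-HOM (5)
(`KatoDescentKummerLogLinear.lean`, `ContraCount.logHom_display`) being theorems. Conditional reduction; closes nothing by
itself. [cite: Kato2004Asterisque, §13.9–13.12 (pp. 229–231), §14.9 (14.9.3) (p. 240), §14.14 (p. 243) and Prop. 14.16 (p. 244)]
[cite: BlochKato1990, Def. 3.10 and Ex. 3.11] [cite: BurnsKuriharaSano2019, Thm. 7.3 and Thm. 7.8 (d)] -/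
theorem rankOneCountReading_contra_of_facts_of_gzk
    (hGZK : rank_eq_analyticRank_of_analyticRank_le_one)
    (hfd : Kato2004.finite_descentCokernel_of_rankOne)
    (hlev : ∀ (N : ℕ) [NeZero N], IsNewformOf.level_eq_conductorNorm (N := N))
    (hPRinv : ∀ (W : WeierstrassCurve ℚ) [W.IsElliptic] [W.IsGloballyMinimal] (p : ℕ) [Fact p.Prime]
      (ℒ₁ ℒ₂ : ℚ_[p]), Kato2004.PRRatio W p ℒ₁ → Kato2004.PRRatio W p ℒ₂ → ∃ w : ℚ_[p], ‖w‖ = 1 ∧ ℒ₂ = w * ℒ₁)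
    (hCount : ∀ (W : WeierstrassCurve ℚ) [W.IsElliptic] [W.IsGloballyMinimal] (p : ℕ) [Fact p.Prime],
      letI : ContinuousSMul ℤ_[p] (W.tateModule p) := TateModule.continuousSMul_padicInt
      ∀ (κ : ZpExtension ℚ p) (γ : absoluteGaloisGroup ℚ), κ.IsCyclotomic → κ.IsTopGenerator γ →
        ∀ (I : IwasawaH1Data W p κ γ) (J : IwasawaH2Data W p κ γ I) (x : I.H) (s : ℚ_[p])
          (P : W.toAffine.Point),
          W.analyticRank = 1 → p ≠ 2 → Addv W p → 0 ≤ padicValRat p W.j → ¬ p ∣ W.torsionOrder →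
          Finite W.sha →
          (∀ (Y : W.FineSelmerDualData κ γ⁻¹) (𝔮 : PrimeSpectrum (IwasawaAlgebra p)), 𝔮.asIdeal.height = 1 →
            Module.lengthAt (IwasawaAlgebra p) J.H2 𝔮 = Module.lengthAt (IwasawaAlgebra p) Y.X 𝔮) →
          (∀ Q : W.toAffine.Point, ∃ n : ℤ, IsOfFinAddOrder (Q - n • P)) →
          HasLocPKummerLog W p (layerZeroToTop W p κ (I.proj 0 x)) s →
          (s ≠ 0 ↔ Nat.card (J.A ⧸ (IwasawaAlgebra p) ∙ J.ι (Submodule.Quotient.mk x)) ≠ 0) ∧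
            ∀ m : ℕ, Nat.card (J.A ⧸ (IwasawaAlgebra p) ∙ J.ι (Submodule.Quotient.mk x)) =
                p ^ m * Nat.card (coinvariants p J.H2) →
              s.valuation = (m : ℤ) + padicValNat p (Nat.card (AddCommGroup.primaryComponent W.sha p)) +
                padicValNat p W.tamagawaProduct +
                2 * (padicLogLocal W p
                  (WeierstrassCurve.Affine.Point.map (W' := W.toAffine) (S := ℚ) (Algebra.ofId ℚ ℚ_[p]) P)).valuation) :
    TorsionFree.RankOneCountReading IsKatoZetaDescentDatumOfContra Kato2004.PRRatio :=
  ContraCount.rankOneCountReading_contra_of_facts_of_logHom hGZK hfd hlev (logEx_of_gzk hGZK) hPRinv hCount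

end Summit.BirchSwinnertonDyer.Rank1Residual.Additive.LocPKummer

end
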